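import Literature.MathematicalPhysics.QuantumManyBody.DyadicCoherentFractionRefinement
import Literature.MathematicalPhysics.QuantumManyBody.PeriodicBoseGas
import Mathlib.Analysis.SpecialFunctions.Integrals.Basic
import Mathlib.MeasureTheory.Integral.Pi
import Mathlib.Analysis.MeanInequalities
import Mathlib.Analysis.Real.Pi.Bounds

/-!
# Route `BECDyadicChaining`, crux `BaseCoherentMass` — helpers for the free-gas base (`stub_freeBase`)

Auxiliary lemmas for the free branch of
`Summit.AtomisticToContinuum.BoseEinsteinCondensation.Theses.BECDyadicChaining.BaseCoherentMass`
(stmt-AtomisticToContinuum-13193), used by `BECDyadicChainingBaseCoherentMassFreeBase.lean`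
(stub `stub_freeBase` of the registered line). Registered helper: `freeBase_integral_sin_pi_div`.

* `freeBase_integral_sin_pi_div`, `integral_sin_pi_mul_div_sq`, `setIntegral_Ico_sineMode(_sq)` —
  `∫₀ᴸ sin(πt/L) dt = 2L/π`, `∫₀ᴸ sin²(πt/L) dt = L/2`: the one-dimensional Dirichlet ground mode
  `√(2/L) sin(πt/L)` of `(0, L)` has unit norm and mass `√(2/L)·2L/π`;
* `setIntegral_cell_prod_eq_pow` — a product function integrates over the half-open cube `[0,L)³` to the
  cube of the one-dimensional integral (Fubini through `EuclideanSpace ℝ (Fin 3) ≃ᵐ (Fin 3 → ℝ)`);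
* `lintegral_nnnorm_sub_proj_sq_add` — Pythagoras for the rank-one projection onto a unit vector `S` of
  `L²`: `‖f - ⟨S,f⟩ S‖² + |⟨S,f⟩|² = ‖f‖²`, in the `ℝ≥0∞` currency of `occupation`;
* `enorm_mul_rpow_half_lintegral_le` — Minkowski in `L²(dY)` for Gram vectors, `‖a c‖ ≤ ‖u‖ + ‖u - a c‖`;
* `sum_nnnorm_flatPairing_sq_le_setLIntegral` — Bessel for the orthonormal flat modes `dyMode L K ·` of
  one dyadic level against a measurable one-body function: `∑_B |⟨φ_B, g⟩|² ≤ ∫_{[0,L)³} |g|²`;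
* the sine mode `s(x) = ∏ₖ √(2/L) sin(πxₖ/L)` on the cube: bounded (`abs_sineMode_le`), nonnegative
  (`sineMode_nonneg_of_mem_cell`), integrable (`integrableOn_sineMode_cell`,
  `integrableOn_norm_sineMode_sq_cell`), normalised (`setIntegral_cell_norm_sineMode_sq`), of mass
  `(√(2/L)·2L/π)³` (`setIntegral_cell_sineMode`), whence the overlap constant with the flat modes of
  level `K`: `(s_K³)^{-1/2} ∫ s = 8^{K/2}(2√2/π)³ ≥ (7/10)·8^{K/2}` (`sineMode_overlap_ge`, `π < 3.15`).

All [folklore] (calculus and Hilbert-space bookkeeping; [LSSY2005, §1.2 (1.17)] for the occupation).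
-/

noncomputable section

namespace Summit.AtomisticToContinuum.BoseEinsteinCondensation.Theorems.BaseCoherentMass

open MeasureTheory
open scoped ENNReal NNReal ComplexConjugate
open Literature.MathematicalPhysics.QuantumManyBody.BoseGas

/-! ### One-dimensional sine integrals -/

/-- `∫₀ᴸ sin(πt/L) dt = 2L/π` for `L > 0` (registered helper signature of the free-gas base).
[folklore] -/
theorem freeBase_integral_sin_pi_div : ∀ (L : ℝ), 0 < L → ∫ t in (0 : ℝ)..L, Real.sin (Real.pi * t / L) = 2 * L / Real.pi := by
  intro L hL
  have hc : Real.pi / L ≠ 0 := (div_pos Real.pi_pos hL).ne'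
  have h1 : (fun t => Real.sin (Real.pi * t / L)) = fun t => Real.sin (Real.pi / L * t) := by
    funext t; congr 1; ring
  rw [h1, intervalIntegral.integral_comp_mul_left (fun u => Real.sin u) hc, integral_sin, mul_zero,
    div_mul_cancel₀ _ hL.ne', Real.cos_zero, Real.cos_pi, smul_eq_mul]
  field_simp
  ring

/-- `∫₀ᴸ sin²(πt/L) dt = L/2` for `L > 0`. [folklore] -/
theorem integral_sin_pi_mul_div_sq {L : ℝ} (hL : 0 < L) :
    ∫ t in (0 : ℝ)..L, Real.sin (Real.pi * t / L) ^ 2 = L / 2 := by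
  have hc : Real.pi / L ≠ 0 := (div_pos Real.pi_pos hL).ne'
  have h1 : (fun t => Real.sin (Real.pi * t / L) ^ 2) = fun t => (fun u => Real.sin u ^ 2) (Real.pi / L * t) := by
    funext t; simp only; congr 2; ring
  rw [h1, intervalIntegral.integral_comp_mul_left (fun u => Real.sin u ^ 2) hc, integral_sin_sq, mul_zero,
    div_mul_cancel₀ _ hL.ne', Real.sin_zero, Real.sin_pi, smul_eq_mul]
  field_simp
  ring

/-- The normalised one-dimensional mode: `∫_{[0,L)} (√(2/L) sin(πt/L))² dt = 1`. [folklore] -/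
theorem setIntegral_Ico_sineMode_sq {L : ℝ} (hL : 0 < L) :
    ∫ t in Set.Ico (0 : ℝ) L, (Real.sqrt (2 / L) * Real.sin (Real.pi * t / L)) ^ 2 = 1 := by
  rw [integral_Ico_eq_integral_Ioc, ← intervalIntegral.integral_of_le hL.le]
  simp_rw [mul_pow, Real.sq_sqrt (by positivity : (0 : ℝ) ≤ 2 / L)]
  rw [intervalIntegral.integral_const_mul, integral_sin_pi_mul_div_sq hL]
  field_simp

/-- The mass of the one-dimensional mode: `∫_{[0,L)} √(2/L) sin(πt/L) dt = √(2/L) · 2L/π`. [folklore] -/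
theorem setIntegral_Ico_sineMode {L : ℝ} (hL : 0 < L) :
    ∫ t in Set.Ico (0 : ℝ) L, Real.sqrt (2 / L) * Real.sin (Real.pi * t / L) =
      Real.sqrt (2 / L) * (2 * L / Real.pi) := by
  rw [integral_Ico_eq_integral_Ioc, ← intervalIntegral.integral_of_le hL.le,
    intervalIntegral.integral_const_mul, freeBase_integral_sin_pi_div L hL]

/-! ### Product functions over the half-open cube -/

/-- **Fubini for product functions on the cube**: `∫_{[0,L)³} ∏ₖ φ(xₖ) dx = (∫_{[0,L)} φ)³`
(the identification `ℝ³ ≃ (Fin 3 → ℝ)` preserves Lebesgue measure). [folklore] -/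
theorem setIntegral_cell_prod_eq_pow (L : ℝ) (φ : ℝ → ℝ) :
    ∫ x in cell L, (∏ k : Fin 3, φ (x k)) = (∫ t in Set.Ico (0 : ℝ) L, φ t) ^ 3 := by
  set e := (MeasurableEquiv.toLp 2 (Fin 3 → ℝ)).symm with he
  have hmp : MeasurePreserving e volume volume :=
    EuclideanSpace.volume_preserving_symm_measurableEquiv_toLp (Fin 3)
  have hcell : cell L = e ⁻¹' (Set.univ.pi fun _ => Set.Ico (0 : ℝ) L) := by
    ext x; simp [cell, he]
  set G : (Fin 3 → ℝ) → ℝ := fun y => ∏ k : Fin 3, φ (y k) with hG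
  have hint : ∀ x : Space, (∏ k : Fin 3, φ (x k)) = G (e x) := by
    intro x; simp [he, hG]
  simp_rw [hint]
  rw [hcell, hmp.setIntegral_preimage_emb e.measurableEmbedding, volume_pi, Measure.restrict_pi_pi, hG,
    integral_fintype_prod_eq_prod (𝕜 := ℝ) (fun (_ : Fin 3) (t : ℝ) => φ t)]
  simp

/-! ### Pythagoras for a rank-one projection, in `ℝ≥0∞` -/

/-- **Pythagoras for the projection onto a unit vector.** For `S` with `∫ ‖S‖² = 1` and
`c = ∫ conj(S) f`: `∫ ‖f - c S‖² + |c|² = ∫ ‖f‖²` (lower Lebesgue integrals; `f`, `S` square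
integrable and `conj(S) f` integrable). [folklore] -/
theorem lintegral_nnnorm_sub_proj_sq_add {α : Type*} [MeasurableSpace α] (μ : Measure α) {f S : α → ℂ}
    (hf2 : Integrable (fun x => ‖f x‖ ^ 2) μ) (hS2 : Integrable (fun x => ‖S x‖ ^ 2) μ)
    (hSf : Integrable (fun x => conj (S x) * f x) μ) (hS1 : ∫ x, ‖S x‖ ^ 2 ∂μ = 1) :
    (∫⁻ x, (‖f x - (∫ y, conj (S y) * f y ∂μ) * S x‖₊ : ℝ≥0∞) ^ 2 ∂μ) +
      (‖∫ y, conj (S y) * f y ∂μ‖₊ : ℝ≥0∞) ^ 2 = ∫⁻ x, (‖f x‖₊ : ℝ≥0∞) ^ 2 ∂μ := by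
  set c : ℂ := ∫ y, conj (S y) * f y ∂μ with hc
  -- pointwise expansion of the square
  have hpt : ∀ x, ‖f x - c * S x‖ ^ 2 =
      ‖f x‖ ^ 2 + ‖c‖ ^ 2 * ‖S x‖ ^ 2 - 2 * RCLike.re (conj c * (conj (S x) * f x)) := by
    intro x
    have hm : f x * conj (c * S x) = conj c * (conj (S x) * f x) := by rw [map_mul]; ring
    simp only [← Complex.normSq_eq_norm_sq]
    rw [Complex.normSq_sub, Complex.normSq_mul, hm]
    rfl
  have hre : Integrable (fun x => RCLike.re (conj c * (conj (S x) * f x))) μ := (hSf.const_mul _).re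
  have hA : Integrable (fun x => ‖f x‖ ^ 2 + ‖c‖ ^ 2 * ‖S x‖ ^ 2) μ := hf2.add (hS2.const_mul _)
  have hB : Integrable (fun x => 2 * RCLike.re (conj c * (conj (S x) * f x))) μ := hre.const_mul 2
  have hg : Integrable (fun x => ‖f x - c * S x‖ ^ 2) μ := by
    have : (fun x => ‖f x - c * S x‖ ^ 2) =
        fun x => ‖f x‖ ^ 2 + ‖c‖ ^ 2 * ‖S x‖ ^ 2 - 2 * RCLike.re (conj c * (conj (S x) * f x)) :=
      funext hpt
    rw [this]
    exact hA.sub hB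
  -- the real identity
  have key : ∫ x, ‖f x - c * S x‖ ^ 2 ∂μ = (∫ x, ‖f x‖ ^ 2 ∂μ) - ‖c‖ ^ 2 := by
    simp_rw [hpt]
    rw [integral_sub hA hB, integral_add hf2 (hS2.const_mul _),
      integral_const_mul, hS1, mul_one, integral_const_mul, integral_re (hSf.const_mul _),
      integral_const_mul, ← hc, Complex.conj_mul']
    have : RCLike.re ((‖c‖ : ℂ) ^ 2) = ‖c‖ ^ 2 := by
      rw [← Complex.ofReal_pow]; exact Complex.ofReal_re _
    rw [this]
    ring
  have hnn : 0 ≤ (∫ x, ‖f x‖ ^ 2 ∂μ) - ‖c‖ ^ 2 := by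
    rw [← key]; exact integral_nonneg fun _ => by positivity
  simp only [nnnorm_coe_sq_eq_ofReal]
  rw [← ofReal_integral_eq_lintegral_ofReal hg (ae_of_all _ fun _ => by positivity),
    ← ofReal_integral_eq_lintegral_ofReal hf2 (ae_of_all _ fun _ => by positivity), key,
    ← ENNReal.ofReal_add hnn (by positivity), sub_add_cancel]

/-! ### Minkowski bookkeeping in `ℝ≥0∞` -/

/-- `(∫ ‖g‖₊²)^{1/2}` is the `L²` quasi-norm `eLpNorm' g 2`. [folklore] -/
theorem rpow_half_lintegral_nnnorm_sq_eq_eLpNorm' {α : Type*} [MeasurableSpace α] (μ : Measure α)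
    (g : α → ℂ) : (∫⁻ Y, (‖g Y‖₊ : ℝ≥0∞) ^ 2 ∂μ) ^ (1 / 2 : ℝ) = eLpNorm' g 2 μ := by
  rw [eLpNorm'_eq_lintegral_enorm]
  simp only [enorm_eq_nnnorm, ENNReal.rpow_two]

/-- **Minkowski for Gram vectors.** If `a · c(Y) = u(Y) - w(Y)` for all `Y` (`u`, `w` a.e. strongly
measurable), then `‖a‖ ‖c‖_{L²} ≤ ‖u‖_{L²} + ‖w‖_{L²}`, written with `(∫ ‖·‖₊²)^{1/2}`. [folklore] -/
theorem enorm_mul_rpow_half_lintegral_le {α : Type*} [MeasurableSpace α] {μ : Measure α}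
    {u w c : α → ℂ} (hu : AEStronglyMeasurable u μ) (hw : AEStronglyMeasurable w μ) (a : ℂ)
    (h : ∀ Y, a * c Y = u Y - w Y) :
    ‖a‖ₑ * (∫⁻ Y, (‖c Y‖₊ : ℝ≥0∞) ^ 2 ∂μ) ^ (1 / 2 : ℝ) ≤
      (∫⁻ Y, (‖u Y‖₊ : ℝ≥0∞) ^ 2 ∂μ) ^ (1 / 2 : ℝ) + (∫⁻ Y, (‖w Y‖₊ : ℝ≥0∞) ^ 2 ∂μ) ^ (1 / 2 : ℝ) := by
  have hfun : a • c = u + -w := by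
    funext Y
    simp only [Pi.smul_apply, smul_eq_mul, Pi.add_apply, Pi.neg_apply, h Y, sub_eq_add_neg]
  rw [rpow_half_lintegral_nnnorm_sq_eq_eLpNorm', rpow_half_lintegral_nnnorm_sq_eq_eLpNorm',
    rpow_half_lintegral_nnnorm_sq_eq_eLpNorm', ← eLpNorm'_const_smul a (by norm_num : (0 : ℝ) < 2), hfun]
  calc eLpNorm' (u + -w) 2 μ ≤ eLpNorm' u 2 μ + eLpNorm' (-w) 2 μ := eLpNorm'_add_le hu hw.neg (by norm_num)
    _ = eLpNorm' u 2 μ + eLpNorm' w 2 μ := by rw [eLpNorm'_neg]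

/-! ### Bessel for the flat modes of one dyadic level -/

/-- **Bessel per level for a one-body function.** For `L > 0`, a level `K` and a measurable
`g : ℝ³ → ℂ`: `∑_B ‖(s³)^{-1/2} ∫_B g‖₊² ≤ ∫_{[0,L)³} ‖g‖₊²` (`s = L/2^K`; Cauchy–Schwarz on each
half-open cell, the cells partition `[0,L)³`). [folklore] -/
theorem sum_nnnorm_flatPairing_sq_le_setLIntegral {L : ℝ} (hL : 0 < L) (K : ℕ) {g : Space → ℂ}
    (hg : Measurable g) :
    ∑ i : Fin 3 → Fin (2 ^ K), ((‖((Real.sqrt ((L / 2 ^ K) ^ 3))⁻¹ : ℂ) *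
        ∫ x in dyCell L K i, g x‖₊ : ℝ≥0∞) ^ 2) ≤ ∫⁻ x in cell L, (‖g x‖₊ : ℝ≥0∞) ^ 2 := by
  have hs : 0 < L / 2 ^ K := by positivity
  have hcell : ∀ i : Fin 3 → Fin (2 ^ K), ((‖((Real.sqrt ((L / 2 ^ K) ^ 3))⁻¹ : ℂ) *
      ∫ x in dyCell L K i, g x‖₊ : ℝ≥0∞) ^ 2) ≤ ∫⁻ x in dyCell L K i, (‖g x‖₊ : ℝ≥0∞) ^ 2 := by
    intro i
    rw [nnnorm_mul, ENNReal.coe_mul, mul_pow, nnnorm_flatAmp_sq hs]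
    calc ENNReal.ofReal (((L / 2 ^ K) ^ 3)⁻¹) * ((‖∫ x in dyCell L K i, g x‖₊ : ℝ≥0∞) ^ 2)
        ≤ ENNReal.ofReal (((L / 2 ^ K) ^ 3)⁻¹) * (volume (dyCell L K i) *
            ∫⁻ x in dyCell L K i, (‖g x‖₊ : ℝ≥0∞) ^ 2) := by
          gcongr
          simpa only [Measure.restrict_apply_univ] using
            nnnorm_integral_sq_le_mul_lintegral (volume.restrict (dyCell L K i)) hg.aemeasurable
      _ = ∫⁻ x in dyCell L K i, (‖g x‖₊ : ℝ≥0∞) ^ 2 := by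
          rw [volume_dyCell, ← mul_assoc, ← ENNReal.ofReal_pow hs.le, ← ENNReal.ofReal_mul (by positivity),
            inv_mul_cancel₀ (by positivity), ENNReal.ofReal_one, one_mul]
  have hU : (⋃ i ∈ (Finset.univ : Finset (Fin 3 → Fin (2 ^ K))), dyCell L K i) = cell L := by
    rw [cell, ← iUnion_dyCell L K]; simp
  calc ∑ i : Fin 3 → Fin (2 ^ K), ((‖((Real.sqrt ((L / 2 ^ K) ^ 3))⁻¹ : ℂ) *
        ∫ x in dyCell L K i, g x‖₊ : ℝ≥0∞) ^ 2)
      ≤ ∑ i : Fin 3 → Fin (2 ^ K), ∫⁻ x in dyCell L K i, (‖g x‖₊ : ℝ≥0∞) ^ 2 :=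
        Finset.sum_le_sum fun i _ => hcell i
    _ = ∫⁻ x in ⋃ i ∈ (Finset.univ : Finset (Fin 3 → Fin (2 ^ K))), dyCell L K i, (‖g x‖₊ : ℝ≥0∞) ^ 2 :=
        (lintegral_biUnion_finset (fun i _ j _ h => disjoint_dyCell h)
          (fun i _ => measurableSet_dyCell L K i) _).symm
    _ = ∫⁻ x in cell L, (‖g x‖₊ : ℝ≥0∞) ^ 2 := by rw [hU]

/-! ### The sine mode `s(x) = ∏ₖ √(2/L) sin(π xₖ/L)` on the half-open cube -/

/-- `|s(x)| ≤ (2/L)^{3/2}` everywhere. [folklore] -/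
theorem abs_sineMode_le (L : ℝ) (x : Space) :
    |∏ k : Fin 3, (Real.sqrt (2 / L) * Real.sin (Real.pi * x k / L))| ≤ Real.sqrt (2 / L) ^ 3 := by
  rw [Finset.abs_prod]
  calc ∏ k : Fin 3, |Real.sqrt (2 / L) * Real.sin (Real.pi * x k / L)|
      ≤ ∏ _k : Fin 3, Real.sqrt (2 / L) :=
        Finset.prod_le_prod (fun k _ => abs_nonneg _) fun k _ => by
          rw [abs_mul, abs_of_nonneg (Real.sqrt_nonneg _)]
          exact mul_le_of_le_one_right (Real.sqrt_nonneg _) (Real.abs_sin_le_one _)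
    _ = Real.sqrt (2 / L) ^ 3 := by rw [Finset.prod_const, Finset.card_univ, Fintype.card_fin]

/-- `s ≥ 0` on the half-open cube `[0,L)³` (each `sin(π xₖ/L) ≥ 0` for `xₖ ∈ [0, L)`). [folklore] -/
theorem sineMode_nonneg_of_mem_cell {L : ℝ} (hL : 0 < L) {x : Space} (hx : x ∈ cell L) :
    0 ≤ ∏ k : Fin 3, (Real.sqrt (2 / L) * Real.sin (Real.pi * x k / L)) := by
  refine Finset.prod_nonneg fun k _ => mul_nonneg (Real.sqrt_nonneg _) ?_
  obtain ⟨h0, h1⟩ := hx k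
  refine Real.sin_nonneg_of_nonneg_of_le_pi (by positivity) ?_
  rw [div_le_iff₀ hL]
  nlinarith [Real.pi_pos]

/-- `s` is integrable on the half-open cube (bounded, finite volume). [folklore] -/
theorem integrableOn_sineMode_cell (L : ℝ) :
    IntegrableOn (fun x : Space => ∏ k : Fin 3, (Real.sqrt (2 / L) * Real.sin (Real.pi * x k / L)))
      (cell L) := by
  refine Measure.integrableOn_of_bounded (M := Real.sqrt (2 / L) ^ 3) ?_ ?_ ?_
  · rw [volume_cell]; exact ENNReal.pow_ne_top ENNReal.ofReal_ne_top
  · exact (by fun_prop : Continuous fun x : Space =>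
      ∏ k : Fin 3, (Real.sqrt (2 / L) * Real.sin (Real.pi * x k / L))).aestronglyMeasurable
  · exact ae_of_all _ fun x => by rw [Real.norm_eq_abs]; exact abs_sineMode_le L x

/-- `|s|²` (of the complexified mode) is integrable on the half-open cube. [folklore] -/
theorem integrableOn_norm_sineMode_sq_cell (L : ℝ) :
    IntegrableOn (fun x : Space =>
      ‖((∏ k : Fin 3, (Real.sqrt (2 / L) * Real.sin (Real.pi * x k / L)) : ℝ) : ℂ)‖ ^ 2) (cell L) := by
  refine Measure.integrableOn_of_bounded (M := (Real.sqrt (2 / L) ^ 3) ^ 2) ?_ ?_ ?_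
  · rw [volume_cell]; exact ENNReal.pow_ne_top ENNReal.ofReal_ne_top
  · exact (by fun_prop : Continuous fun x : Space =>
      ‖((∏ k : Fin 3, (Real.sqrt (2 / L) * Real.sin (Real.pi * x k / L)) : ℝ) : ℂ)‖ ^ 2).aestronglyMeasurable
  · refine ae_of_all _ fun x => ?_
    rw [Real.norm_eq_abs, abs_pow, abs_norm, Complex.norm_real, Real.norm_eq_abs]
    exact pow_le_pow_left₀ (abs_nonneg _) (abs_sineMode_le L x) 2

/-- **`s` is normalised on the cube**: `∫_{[0,L)³} |s|² = 1` (`L > 0`). [folklore] -/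
theorem setIntegral_cell_norm_sineMode_sq {L : ℝ} (hL : 0 < L) :
    ∫ x in cell L, ‖((∏ k : Fin 3, (Real.sqrt (2 / L) * Real.sin (Real.pi * x k / L)) : ℝ) : ℂ)‖ ^ 2 = 1 := by
  have h : ∀ x : Space, ‖((∏ k : Fin 3, (Real.sqrt (2 / L) * Real.sin (Real.pi * x k / L)) : ℝ) : ℂ)‖ ^ 2 =
      ∏ k : Fin 3, (Real.sqrt (2 / L) * Real.sin (Real.pi * x k / L)) ^ 2 := fun x => by
    rw [Complex.norm_real, Real.norm_eq_abs, sq_abs, Finset.prod_pow]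
  simp_rw [h]
  rw [setIntegral_cell_prod_eq_pow L fun t => (Real.sqrt (2 / L) * Real.sin (Real.pi * t / L)) ^ 2,
    setIntegral_Ico_sineMode_sq hL, one_pow]

/-- **The mass of `s` on the cube**: `∫_{[0,L)³} s = (√(2/L) · 2L/π)³` (`L > 0`). [folklore] -/
theorem setIntegral_cell_sineMode {L : ℝ} (hL : 0 < L) :
    ∫ x in cell L, (∏ k : Fin 3, (Real.sqrt (2 / L) * Real.sin (Real.pi * x k / L))) =
      (Real.sqrt (2 / L) * (2 * L / Real.pi)) ^ 3 := by
  rw [setIntegral_cell_prod_eq_pow L fun t => Real.sqrt (2 / L) * Real.sin (Real.pi * t / L),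
    setIntegral_Ico_sineMode hL]

/-- **The overlap constant.** `(s_K³)^{-1/2} ∫_{[0,L)³} s = 8^{K/2} (2√2/π)³ ≥ (7/10) 8^{K/2}`
(`s_K = L/2^K`; numerically `(2√2/π)³ = 0.7298…`, using `π < 3.15`). [folklore] -/
theorem sineMode_overlap_ge {L : ℝ} (hL : 0 < L) (K : ℕ) :
    7 / 10 * Real.sqrt (8 ^ K) ≤
      (Real.sqrt ((L / 2 ^ K) ^ 3))⁻¹ * (Real.sqrt (2 / L) * (2 * L / Real.pi)) ^ 3 := by
  have h2K : (0 : ℝ) < 2 ^ K := by positivity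
  have hsK : 0 < (L / 2 ^ K) ^ 3 := by positivity
  have h8 : (8 : ℝ) ^ K = (2 ^ K) ^ 3 := by rw [← pow_mul, mul_comm, pow_mul]; norm_num
  set κ : ℝ := (Real.sqrt ((L / 2 ^ K) ^ 3))⁻¹ * (Real.sqrt (2 / L) * (2 * L / Real.pi)) ^ 3 with hκ
  have hκ0 : 0 ≤ κ := by positivity
  have hκ2 : κ ^ 2 * Real.pi ^ 6 = 512 * (2 ^ K) ^ 3 := by
    have hπ : Real.pi ≠ 0 := Real.pi_pos.ne'
    have hL0 : L ≠ 0 := hL.ne'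
    have h3 : ((Real.sqrt (2 / L) * (2 * L / Real.pi)) ^ 3) ^ 2 = ((2 / L) * (2 * L / Real.pi) ^ 2) ^ 3 := by
      rw [← pow_mul, mul_comm 3 2, pow_mul, mul_pow, Real.sq_sqrt (by positivity : (0 : ℝ) ≤ 2 / L)]
    rw [hκ, mul_pow, inv_pow, Real.sq_sqrt hsK.le, h3]
    field_simp
    ring
  have hπ6 : Real.pi ^ 6 < 3.15 ^ 6 := pow_lt_pow_left₀ Real.pi_lt_d2 Real.pi_pos.le (by norm_num)
  have hle : (7 / 10 * Real.sqrt (8 ^ K)) ^ 2 ≤ κ ^ 2 := by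
    have h1 : 512 * ((2 : ℝ) ^ K) ^ 3 ≤ κ ^ 2 * 3.15 ^ 6 := by
      rw [← hκ2]; exact mul_le_mul_of_nonneg_left hπ6.le (sq_nonneg κ)
    rw [mul_pow, Real.sq_sqrt (by positivity), h8]
    nlinarith [h1, pow_pos h2K 3]
  calc 7 / 10 * Real.sqrt (8 ^ K) = Real.sqrt ((7 / 10 * Real.sqrt (8 ^ K)) ^ 2) :=
        (Real.sqrt_sq (by positivity)).symm
    _ ≤ Real.sqrt (κ ^ 2) := Real.sqrt_le_sqrt hle
    _ = κ := Real.sqrt_sq hκ0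

/-- Every dyadic cell of level `K` lies in the half-open cube `[0,L)³`. [folklore] -/
theorem dyCell_subset_cell (L : ℝ) (K : ℕ) (i : Fin 3 → Fin (2 ^ K)) : dyCell L K i ⊆ cell L :=
  fun _ hx => (iUnion_dyCell L K).subset (Set.mem_iUnion.2 ⟨i, hx⟩)

/-- The open box lies in the half-open cube. [folklore] -/
theorem box_subset_cell (L : ℝ) : box L ⊆ cell L := fun _ hx k => Set.Ioo_subset_Ico_self (hx k)

end Summit.AtomisticToContinuum.BoseEinsteinCondensation.Theorems.BaseCoherentMass

end
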